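import Summits.ResolutionOfSingularities.ResolutionOfSingularities.Theorems.FrobeniusClosingPatchingRelPerfectDepthFlagFormatStep
import Summits.ResolutionOfSingularities.ResolutionOfSingularities.Theorems.FrobeniusClosingPatchingRelPerfectDepthFlagSepCompositions
import HarnessLib

/-!
# Crux `PatchingRelPerfect` (stmt-ResolutionOfSingularities-16161), chain W5.2 — F6: the WEIGHT-TWO TOWER of stage 1 for the flag
# format, `DepthTargets.TowerFlagTwo DepthGraded.FlagFormat`, by name (lead prover, gen 4)

[OURS · L1 W5.2 · lead] Replaces the role of NO printed item; NOT a statement of the manuscript under review.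
plan-1's composition `towerFlagTwo_of_stepFlagTwo` (TargetsF6 §7, tree `…DepthFlagSepCompositions`) applied to
`stepFlagTwo_flagFormat` (`…DepthFlagFormatStep`): every `IsFlagSeq` on the E-side is matched by a pure weight-two sequence upstairs
with literal contact, the restriction law and the flag format at the end — the `htower₁` input of `flagEngineTwo_threefold`.
Fact-free; AI-written, weaker than expert review. [cite: Kollar2007, (3.111) Step 3]
-/

-- `Summit.<Summit>.<Sub>.Theorems` with `Sub = Summit` (single-conjunct summit, D-0017)
set_option linter.dupNamespace false

noncomputable section

namespace Summit.ResolutionOfSingularities.ResolutionOfSingularities.Theorems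

universe u

namespace DepthGraded

open DepthTargets

/-- [OURS · L1 W5.2 · lead] **`TowerFlagTwo FlagFormat`**: the weight-two tower of stage 1 for the flag format.
[cite: Kollar2007, (3.111) Step 3] [cite: KawanoueMatsuki2016, §2] -/
theorem towerFlagTwo_flagFormat : TowerFlagTwo FlagFormat.{u} :=
  towerFlagTwo_of_stepFlagTwo stepFlagTwo_flagFormat

end DepthGraded

end Summit.ResolutionOfSingularities.ResolutionOfSingularities.Theorems

end
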